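import Mathlib
import Summits.MatrixMultiplication.MatrixMultiplication.Theses.FidelityWitnesses
import Summits.MatrixMultiplication.MatrixMultiplication.Theorems.FidelityWitnessesFidelityGapTwoSixConeClosure
import Literature.Computability.AlgebraicComplexity.AsymptoticRankZariskiClosedProofs
import Literature.Computability.AlgebraicComplexity.BorderRankLimit
import Literature.Computability.AlgebraicComplexity.AlderStrassenProofs
import Literature.Computability.AlgebraicComplexity.BorderRankMatMulThreeWindow
import Literature.Computability.AlgebraicComplexity.SmallFormatRankLaderman
import Literature.Computability.AlgebraicComplexity.BorderRankMatMulSmallProofs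

/-!
# Disproof of `FidelityGapThreeSeventeen` — findings (standing adversary, crux stmt-MatrixMultiplication-4958)

The crux (route `MatrixMultiplication/FidelityWitnesses`, rank 3):
`∃ ε > 0, ∀ S (tensorRank S ≤ 17), ‖Σ S·⟨3,3,3⟩‖² ≤ (1 − ε)·27·Σ‖S‖²`.

## Findings (index)

* §0 `GapAt`, `FidelityGapThree r` — the crux as the instance `r = 17` of a family (`crux_iff`, `Iff.rfl`).
* §1 REDUCTION (proved, sorry-free): `FidelityGapThree r ↔ ⟨3,3,3⟩ ∉ closure {rank ≤ r} ↔ r < R̲(⟨3,3,3⟩)`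
  (`fidelityGapThree_iff_notMem_closure`, `fidelityGapThree_iff_lt_algBorderRank`; cone criterion
  `Theorems.stub_coneClosure` of the (2,6) line + Alder's theorem, both tree theorems).  Hence
  `crux_iff_eighteen_le_algBorderRank : FidelityGapThreeSeventeen ↔ 18 ≤ R̲(⟨3,3,3⟩)` and the
  FACT-FREE kill switch `crux_false_of_algBorderRank_le_seventeen : R̲(⟨3,3,3⟩) ≤ 17 → ¬ crux`
  (only `mem_closure_setOf_tensorRank_le_of_algBorderRank_le` + continuity).  A disproof IS a
  border-rank-17 approximate algorithm for 3 × 3 matrices, nothing less (open since Smirnov 2013's 20).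
* §2 LOAD-BEARING hypothesis `tensorRank S ≤ 17`: the family is antitone in `r`
  (`fidelityGapThree_antitone`); it is FALSE from `r = 20` on (`not_fidelityGapThree_twenty`, Smirnov's
  kernel-checked scheme) and a fortiori at 23 (Laderman) / 27; it is TRUE at `r = 15`
  (`fidelityGapThree_fifteen`, Landsberg–Michałek `16 ≤ R̲`, tree theorem) and at `r = 16` given the named
  fact CHL 2023 Thm 1.1 (`fidelityGapThree_sixteen_of_CHL` = support item FidelityGapThreeSixteen).
  So any proof must use `r ≤ 19`, and the crux sits exactly at the printed frontier `R̲ ∈ [17, 20]`.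
* §1b CERTIFICATE FORM of a kill: `IsApproxDecomposition h ⟨3,3,3⟩ u v w` with 17 triads → ¬crux
  (`crux_false_of_isApproxDecomposition`), and completeness (`exists_isApproxDecomposition_of_not_crux`).
* §3 TIGHTNESS of `ε`: explicit rank-≤17 tensors bound every admissible gap constant:
  `ε ≤ 10/27` (17 standard triads), `ε ≤ 7/27` (`S20`: TPC `⟨3,3,2⟩:15` block + 2 triads, 20 ones,
  kernel-checked).  §3c BORDER tightness `ε ≤ 2/9` (`P21`: Smirnov `⟨3,2,3;14⟩` padded + 3 monomial
  triads = kernel-checked order-3 scheme with 17 triads for 21 ones; closure argument).  §3e NUMERICAL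
  OPTIMUM (kit j010991): honest `ε ≤ 4631/25000 ≈ 0.18524` (landing copy `Negative/TightnessHonest.lean`), limit
  identified as a twisted 22-one sub-tensor `P22` — CONJECTURE `bR(P22) ≤ 17` (near-miss, `sorry`), which would give
  the sharp-looking `ε ≤ 5/27`; integer staircase `M(3,r) ≈ 19,20,22,23,25,27`, `r = 15…20`.  §3d the border-rank
  hypothesis strengthening is free (`gapAtBorder_iff`).
* §4 natural strengthenings refuted / near-misses.
* §5 NUMERICS log (kit job ids) and WHY IT RESISTS.
-/

set_option linter.dupNamespace false

namespace Summit.MatrixMultiplication.MatrixMultiplication.Cruxes.FidelityGapThreeSeventeen.Disproof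

open scoped BigOperators ComplexConjugate Polynomial
open Literature.Computability.AlgebraicComplexity
open Summit.MatrixMultiplication.MatrixMultiplication.Theses.FidelityWitnesses (FidelityGapThreeSeventeen
  FidelityGapThreeSixteen)

/-! ## §0 The family `FidelityGapThree r` -/

/-- The format of `3 × 3` matrix multiplication tensors over `ℂ` (tree convention
`a = (x,y)` output, `b = (x,z)`, `c = (z,y)`). -/
abbrev T3 : Type := Fin 3 × Fin 3 → Fin 3 × Fin 3 → Fin 3 × Fin 3 → ℂ

/-- The fidelity-gap inequality at `(3, r)` with constant `ε`: every tensor of rank `≤ r` has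
`|⟨S,⟨3,3,3⟩⟩|² ≤ (1 − ε)·27·‖S‖²`. -/
def GapAt (r : ℕ) (ε : ℝ) : Prop :=
  ∀ S : T3, tensorRank S ≤ r →
    ‖∑ a, ∑ b, ∑ c, S a b c * matMulTensor ℂ 3 3 3 a b c‖ ^ 2 ≤
      (1 - ε) * 27 * ∑ a, ∑ b, ∑ c, ‖S a b c‖ ^ 2

/-- A fidelity gap at `(3, r)`: some `ε > 0` works. The crux is `FidelityGapThree 17`,
the support item `FidelityGapThreeSixteen` is `FidelityGapThree 16`. -/
def FidelityGapThree (r : ℕ) : Prop := ∃ ε : ℝ, 0 < ε ∧ GapAt r ε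

theorem crux_iff : FidelityGapThreeSeventeen ↔ FidelityGapThree 17 := Iff.rfl

theorem sixteen_iff : FidelityGapThreeSixteen ↔ FidelityGapThree 16 := Iff.rfl

/-- The family is antitone in `r` (more triads allowed, harder to have a gap). -/
theorem fidelityGapThree_antitone {r r' : ℕ} (h : r ≤ r') :
    FidelityGapThree r' → FidelityGapThree r := by
  rintro ⟨ε, hε, hgap⟩
  exact ⟨ε, hε, fun S hS => hgap S (hS.trans h)⟩

/-! ## Auxiliary sums for `⟨3,3,3⟩` -/

/-- `Σ_{abc} ⟨n,n,n⟩_{abc} = n³` over any commutative ring (the tensor has `n³` ones). -/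
theorem sum_matMulTensor (K : Type) [CommRing K] (n : ℕ) :
    (∑ a : Fin n × Fin n, ∑ b : Fin n × Fin n, ∑ c : Fin n × Fin n,
      matMulTensor K n n n a b c) = (n : K) ^ 3 := by
  have h1 : ∀ a b : Fin n × Fin n,
      (∑ c : Fin n × Fin n, matMulTensor K n n n a b c) = if a.1 = b.1 then 1 else 0 := by
    intro a b
    by_cases hab : a.1 = b.1
    · rw [if_pos hab, Finset.sum_eq_single (b.2, a.2)]
      · simp [matMulTensor, hab]
      · intro c _ hc
        simp only [matMulTensor]
        rw [if_neg]
        rintro ⟨-, h2, h3⟩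
        exact hc (Prod.ext h2.symm h3.symm)
      · intro h
        exact absurd (Finset.mem_univ _) h
    · rw [if_neg hab]
      exact Finset.sum_eq_zero fun c _ => by
        simp [matMulTensor, hab]
  have h2 : ∀ a : Fin n × Fin n, (∑ b : Fin n × Fin n, if a.1 = b.1 then (1 : K) else 0) = n := by
    intro a
    rw [Fintype.sum_prod_type, Finset.sum_comm]
    simp
  simp_rw [h1, h2]
  simp [Finset.sum_const, Finset.card_univ, Fintype.card_prod, Fintype.card_fin]
  ring

/-- The entries of `⟨3,3,3⟩` are idempotent (`0/1`). -/
theorem matMulTensor_mul_self (a b c : Fin 3 × Fin 3) :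
    matMulTensor ℂ 3 3 3 a b c * matMulTensor ℂ 3 3 3 a b c = matMulTensor ℂ 3 3 3 a b c := by
  simp only [matMulTensor]
  split_ifs <;> simp

/-- `‖⟨3,3,3⟩_{abc}‖² = ⟨3,3,3⟩_{abc}` read in `ℝ`. -/
theorem norm_sq_matMulTensor (a b c : Fin 3 × Fin 3) :
    ‖matMulTensor ℂ 3 3 3 a b c‖ ^ 2 = matMulTensor ℝ 3 3 3 a b c := by
  simp only [matMulTensor]
  split_ifs <;> simp

/-- `‖⟨3,3,3⟩‖² = 27`. -/
theorem normSq_matMulTensor_three :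
    (∑ a : Fin 3 × Fin 3, ∑ b : Fin 3 × Fin 3, ∑ c : Fin 3 × Fin 3,
      ‖matMulTensor ℂ 3 3 3 a b c‖ ^ 2) = (27 : ℝ) := by
  simp_rw [norm_sq_matMulTensor]
  rw [sum_matMulTensor ℝ 3]
  norm_num

/-- The self-overlap `Σ ⟨3,3,3⟩·⟨3,3,3⟩ = 27` (complex). -/
theorem overlap_self :
    (∑ a : Fin 3 × Fin 3, ∑ b : Fin 3 × Fin 3, ∑ c : Fin 3 × Fin 3,
      matMulTensor ℂ 3 3 3 a b c * matMulTensor ℂ 3 3 3 a b c) = (27 : ℂ) := by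
  simp_rw [matMulTensor_mul_self]
  rw [sum_matMulTensor ℂ 3]
  norm_num

/-- Conjugation fixes the real tensor `⟨3,3,3⟩`. -/
theorem conj_matMulTensor (a b c : Fin 3 × Fin 3) :
    (starRingEnd ℂ) (matMulTensor ℂ 3 3 3 a b c) = matMulTensor ℂ 3 3 3 a b c := by
  unfold matMulTensor
  split_ifs <;> simp

/-- Sesquilinear and bilinear overlaps with `⟨3,3,3⟩` have the same norm. -/
theorem norm_overlap_conj (S : T3) :
    ‖∑ a, ∑ b, ∑ c, (starRingEnd ℂ) (S a b c) * matMulTensor ℂ 3 3 3 a b c‖ =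
      ‖∑ a, ∑ b, ∑ c, S a b c * matMulTensor ℂ 3 3 3 a b c‖ := by
  have h : (∑ a, ∑ b, ∑ c, (starRingEnd ℂ) (S a b c) * matMulTensor ℂ 3 3 3 a b c)
      = (starRingEnd ℂ) (∑ a, ∑ b, ∑ c, S a b c * matMulTensor ℂ 3 3 3 a b c) := by
    simp only [map_sum, map_mul, conj_matMulTensor]
  rw [h, Complex.norm_conj]

/-! ## §1 Reduction: the crux is `18 ≤ R̲(⟨3,3,3⟩)` -/

/-- **Easy half of the witness theorem (continuity)**: if `⟨3,3,3⟩` is a limit of rank-`≤ r` tensors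
there is no fidelity gap at `(3, r)` — the strict inequality `(1-ε)·27·‖S‖² < |⟨S,T⟩|²` holds at
`S = T` (`729(1-ε) < 729`) and is an open condition. -/
theorem not_fidelityGapThree_of_mem_closure {r : ℕ}
    (h : matMulTensor ℂ 3 3 3 ∈ closure {S : T3 | tensorRank S ≤ r}) : ¬ FidelityGapThree r := by
  rintro ⟨ε, hε, hgap⟩
  set f : T3 → ℝ := fun S =>
    ‖∑ a, ∑ b, ∑ c, S a b c * matMulTensor ℂ 3 3 3 a b c‖ ^ 2 -
      (1 - ε) * 27 * ∑ a, ∑ b, ∑ c, ‖S a b c‖ ^ 2 with hf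
  have hcont : Continuous f := by
    simp only [hf]
    fun_prop
  have hopen : IsOpen (f ⁻¹' Set.Ioi 0) := hcont.isOpen_preimage _ isOpen_Ioi
  have hT : matMulTensor ℂ 3 3 3 ∈ f ⁻¹' Set.Ioi 0 := by
    simp only [Set.mem_preimage, Set.mem_Ioi, hf, overlap_self, normSq_matMulTensor_three]
    have : ‖(27 : ℂ)‖ = 27 := by
      rw [show (27 : ℂ) = ((27 : ℝ) : ℂ) by norm_num, Complex.norm_real]
      norm_num
    rw [this]
    nlinarith
  obtain ⟨S, hSU, hSC⟩ := mem_closure_iff.1 h _ hopen hT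
  have h1 := hgap S hSC
  simp only [Set.mem_preimage, Set.mem_Ioi, hf] at hSU
  linarith

/-- **Hard half (cone criterion, tree theorem `Theorems.stub_coneClosure`)**: if `⟨3,3,3⟩` is not a
limit of rank-`≤ r` tensors, a uniform gap exists. -/
theorem fidelityGapThree_of_notMem_closure {r : ℕ}
    (h : matMulTensor ℂ 3 3 3 ∉ closure {S : T3 | tensorRank S ≤ r}) : FidelityGapThree r := by
  by_contra hgap
  refine h (Theorems.stub_coneClosure _ (fun c S hS => ?_) _ fun ε hε => ?_)
  · show tensorRank (c • S) ≤ r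
    exact (tensorRank_smul_le c S).trans hS
  · unfold FidelityGapThree GapAt at hgap
    push Not at hgap
    obtain ⟨S, hS, hlt⟩ := hgap ε hε
    refine ⟨S, hS, ?_⟩
    rw [norm_overlap_conj, normSq_matMulTensor_three]
    have hcomm : (1 - ε) * (∑ a, ∑ b, ∑ c, ‖S a b c‖ ^ 2) * 27
        = (1 - ε) * 27 * ∑ a, ∑ b, ∑ c, ‖S a b c‖ ^ 2 := by ring
    rw [hcomm]
    exact hlt

/-- **Witness theorem at `n = 3`**: gap at `(3, r)` iff `⟨3,3,3⟩ ∉ closure {rank ≤ r}`. -/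
theorem fidelityGapThree_iff_notMem_closure (r : ℕ) :
    FidelityGapThree r ↔ matMulTensor ℂ 3 3 3 ∉ closure {S : T3 | tensorRank S ≤ r} :=
  ⟨fun h hmem => not_fidelityGapThree_of_mem_closure hmem h, fidelityGapThree_of_notMem_closure⟩

/-- **Border-rank form** (Alder's theorem, proved in the tree): gap at `(3, r)` iff `r < R̲(⟨3,3,3⟩)`. -/
theorem fidelityGapThree_iff_lt_algBorderRank (r : ℕ) :
    FidelityGapThree r ↔ r < algBorderRank (matMulTensor ℂ 3 3 3) := by
  rw [fidelityGapThree_iff_notMem_closure,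
    mem_closure_setOf_tensorRank_le_iff alder_secantVariety_eq_setOf_algBorderRank_le_holds, not_le]

/-- **Fact-free kill switch**: a border-rank bound `R̲(⟨3,3,3⟩) ≤ r` refutes the gap at `(3, r)`
(uses only the elementary inclusion `{R̲ ≤ r} ⊆ closure {R ≤ r}` and continuity). -/
theorem not_fidelityGapThree_of_algBorderRank_le {r : ℕ}
    (h : algBorderRank (matMulTensor ℂ 3 3 3) ≤ r) : ¬ FidelityGapThree r :=
  not_fidelityGapThree_of_mem_closure (mem_closure_setOf_tensorRank_le_of_algBorderRank_le h)

/-- **The crux is exactly `18 ≤ R̲(⟨3,3,3⟩)`** (an open problem: printed window `[17, 20]`). -/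
theorem crux_iff_eighteen_le_algBorderRank :
    FidelityGapThreeSeventeen ↔ 18 ≤ algBorderRank (matMulTensor ℂ 3 3 3) :=
  fidelityGapThree_iff_lt_algBorderRank 17

/-- **What a disproof must be**: `R̲(⟨3,3,3⟩) ≤ 17 → ¬ crux` — a border-rank-17 approximate
algorithm for `3 × 3` matrices (one below Smirnov's 20; none is known). Fact-free. -/
theorem crux_false_of_algBorderRank_le_seventeen
    (h : algBorderRank (matMulTensor ℂ 3 3 3) ≤ 17) : ¬ FidelityGapThreeSeventeen :=
  not_fidelityGapThree_of_algBorderRank_le h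

/-- Conversely an honest rank-17 (or approximate order-`h`) scheme is the ONLY way: `¬ crux →
R̲(⟨3,3,3⟩) ≤ 17`. -/
theorem algBorderRank_le_seventeen_of_not_crux (h : ¬ FidelityGapThreeSeventeen) :
    algBorderRank (matMulTensor ℂ 3 3 3) ≤ 17 := by
  rw [crux_iff_eighteen_le_algBorderRank] at h
  omega

/-! ## §1b Certificate form of a kill (what the refuter is searching for)

A disproof in the tree's own currency is an `IsApproxDecomposition h ⟨3,3,3⟩ u v w` with `17` triads
over `ℂ[ε]` (Bläser Def. 6.1) — e.g. integer-polynomial data checked by `decide +kernel` exactly as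
Smirnov's 20 (`BorderRankMatMulThreeSmirnov.check333_eq_true`) or the 17-triad scheme for the 21-one
sub-tensor `P21` in §3c below (`P21Cert.check21_eq_true`, the TEMPLATE: replace its data by a scheme for
all 27 ones and the crux is dead).  Conversely a failure of the crux PRODUCES such a scheme (of some
order `h`), so the search space of the refuter is exactly this. -/

/-- **Certificate-shaped kill switch**: any order-`h` approximate decomposition of `⟨3,3,3⟩` with `17`
triads over `ℂ[ε]` refutes the crux. -/
theorem crux_false_of_isApproxDecomposition {h : ℕ}
    {u v w : Fin 17 → Fin 3 × Fin 3 → ℂ[X]}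
    (H : IsApproxDecomposition h (matMulTensor ℂ 3 3 3) u v w) : ¬ FidelityGapThreeSeventeen :=
  crux_false_of_algBorderRank_le_seventeen
    ((algBorderRank_le_approxRank h _).trans (approxRank_le_of_isApproxDecomposition H))

/-- … equivalently any bound `R_h(⟨3,3,3⟩) ≤ 17` on an order-`h` approximate rank. -/
theorem crux_false_of_approxRank_le {h : ℕ} (H : approxRank h (matMulTensor ℂ 3 3 3) ≤ 17) :
    ¬ FidelityGapThreeSeventeen :=
  crux_false_of_algBorderRank_le_seventeen ((algBorderRank_le_approxRank h _).trans H)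

/-- **Completeness of the certificate format**: if the crux fails, an approximate decomposition of
`⟨3,3,3⟩` with at most `17` triads EXISTS at some order `h`. -/
theorem exists_isApproxDecomposition_of_not_crux (h₀ : ¬ FidelityGapThreeSeventeen) :
    ∃ (h r : ℕ) (u v w : Fin r → Fin 3 × Fin 3 → ℂ[X]), r ≤ 17 ∧
      IsApproxDecomposition h (matMulTensor ℂ 3 3 3) u v w := by
  have h17 := algBorderRank_le_seventeen_of_not_crux h₀
  obtain ⟨h, hh⟩ := exists_algBorderRank_eq_approxRank (matMulTensor ℂ 3 3 3)
  obtain ⟨u, v, w, H⟩ := exists_isApproxDecomposition_approxRank h (matMulTensor ℂ 3 3 3)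
  exact ⟨h, _, u, v, w, hh ▸ h17, H⟩

/-! ## §2 Load-bearing hypothesis: the rank threshold `17` -/

/-- **Dropping the rank bound to `20` kills it**: `¬ FidelityGapThree 20` — Smirnov's approximate
algorithm (`R̲(⟨3,3,3⟩) ≤ 20`, kernel-checked in `BorderRankMatMulThreeSmirnov`). -/
theorem not_fidelityGapThree_twenty : ¬ FidelityGapThree 20 :=
  not_fidelityGapThree_of_algBorderRank_le (Smirnov2013_algBorderRank_matMulTensor_three_le ℂ)

/-- … hence at every `r ≥ 20`. -/
theorem not_fidelityGapThree_of_twenty_le {r : ℕ} (hr : 20 ≤ r) : ¬ FidelityGapThree r :=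
  fun h => not_fidelityGapThree_twenty (fidelityGapThree_antitone hr h)

/-- The weakening "all `S`" (no rank hypothesis at all; equivalently `r = 27`) is false: `S = ⟨3,3,3⟩`. -/
def CruxWithoutRankBound : Prop :=
  ∃ ε : ℝ, 0 < ε ∧ ∀ S : T3,
    ‖∑ a, ∑ b, ∑ c, S a b c * matMulTensor ℂ 3 3 3 a b c‖ ^ 2 ≤
      (1 - ε) * 27 * ∑ a, ∑ b, ∑ c, ‖S a b c‖ ^ 2

theorem crux_false_without_rankBound : ¬ CruxWithoutRankBound := by
  rintro ⟨ε, hε, h⟩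
  have key := h (matMulTensor ℂ 3 3 3)
  rw [overlap_self, normSq_matMulTensor_three] at key
  have : ‖(27 : ℂ)‖ = 27 := by
    rw [show (27 : ℂ) = ((27 : ℝ) : ℂ) by norm_num, Complex.norm_real]
    norm_num
  rw [this] at key
  nlinarith

/-- Honest rank already kills `r = 23` (Laderman 1976, tree theorem), without border arguments. -/
theorem not_fidelityGapThree_twentyThree : ¬ FidelityGapThree 23 := by
  rintro ⟨ε, hε, h⟩
  have key := h (matMulTensor ℂ 3 3 3) (tensorRank_matMulTensor_three_le_twentyThree ℂ)
  rw [overlap_self, normSq_matMulTensor_three] at key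
  have : ‖(27 : ℂ)‖ = 27 := by
    rw [show (27 : ℂ) = ((27 : ℝ) : ℂ) by norm_num, Complex.norm_real]
    norm_num
  rw [this] at key
  nlinarith

/-- **The gap is TRUE two rungs below**: `FidelityGapThree 15`, from the tree theorem
`16 ≤ R̲(⟨3,3,3⟩)` (Landsberg–Michałek 2018 via border substitution + Koszul flattenings). -/
theorem fidelityGapThree_fifteen : FidelityGapThree 15 := by
  rw [fidelityGapThree_iff_lt_algBorderRank]
  have := LandsbergMichalek_sixteen_le_algBorderRank_matMulTensor_three ℂ
  omega

/-- **One rung below = the support item `FidelityGapThreeSixteen`**, which follows from the named fact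
CHL 2023 Thm 1.1 (`17 ≤ R̲(⟨3,3,3⟩)`, border apolarity; not yet proved in the tree). -/
theorem fidelityGapThree_sixteen_of_CHL (h : ConnerHarperLandsberg2023_thm_1_1) : FidelityGapThree 16 := by
  rw [fidelityGapThree_iff_lt_algBorderRank]
  exact h

/-- … and conversely the support item IS that fact. -/
theorem sixteen_iff_CHL : FidelityGapThreeSixteen ↔ ConnerHarperLandsberg2023_thm_1_1 :=
  fidelityGapThree_iff_lt_algBorderRank 16


/-! ## §3 Tightness of `ε`: explicit rank-`≤ 17` tensors of high fidelity

Sub-tensors of `⟨3,3,3⟩` supported on `k` of its `27` ones have rank `≤ k` and fidelity `k/27`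
(`M(3,k) ≥ k`, the partial standard algorithm).  At `k = 17` this bounds every admissible gap
constant: `ε ≤ 10/27` (`gapAt_seventeen_le`).  SHARPER (`gapAt_seventeen_le_seven`): the rank-`≤ 17`
tensor `S20` = Tichavský–Phan–Cichocki's 15-multiplication algorithm for `(3×3)·(3×2)` (the block
`ν ≤ 1` of `⟨3,3,3⟩`, arXiv:1603.01372 §4.2, printed typo `G₁₁ ∋ m₁₂` corrected to `m₁₅`) plus two
standard triads has exactly `20` of the `27` ones: fidelity `20/27`, so `ε ≤ 7/27`, `M(3,17) ≥ 20`.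
The border version (Smirnov's `⟨3,2,3⟩:14` block + 3 triads, `21/27` as a limit, `ε ≤ 2/9`) IS
formalised in §3c (cycle 2); the numerics of §5 estimate how far the true `M(3,17)` is above 21. -/

abbrev Idx : Type := Fin 3 × Fin 3 × Fin 3

section
variable (keep : Idx → Prop) [DecidablePred keep]

/-- the sub-tensor of `⟨3,3,3⟩` keeping the ones indexed by `p = (κ, μ, ν) = (b.1, b.2, a.2)` with `keep p` -/
def subT (K : Type) [CommSemiring K] : Fin 3 × Fin 3 → Fin 3 × Fin 3 → Fin 3 × Fin 3 → K :=
  fun a b c => if (a.1 = b.1 ∧ b.2 = c.1 ∧ a.2 = c.2) ∧ keep (b.1, b.2, a.2) then 1 else 0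

/-- first factor of the `p`-th standard triad, killed unless `keep p` -/
def wK (K : Type) [CommSemiring K] (p : Idx) : Fin 3 × Fin 3 → K :=
  Pi.single (p.1, p.2.2) (if keep p then 1 else 0)

theorem subT_eq_sum_univ (K : Type) [CommSemiring K] :
    subT keep K = ∑ p : Idx, triad (wK keep K p) (Pi.single (p.1, p.2.1) (1 : K))
      (Pi.single (p.2.1, p.2.2) (1 : K)) := by
  funext a b c
  rw [Finset.sum_apply, Finset.sum_apply, Finset.sum_apply]
  simp only [triad_apply]
  obtain ⟨a₁, a₂⟩ := a
  obtain ⟨b₁, b₂⟩ := b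
  obtain ⟨c₁, c₂⟩ := c
  rw [Fintype.sum_eq_single (b₁, b₂, a₂)]
  · simp only [subT, wK, Pi.single_apply, Prod.mk.injEq]
    split_ifs <;> simp_all
  · rintro ⟨κ', μ', ν'⟩ hne
    simp only [ne_eq, Prod.mk.injEq, not_and] at hne
    simp only [wK]
    by_cases h₁ : κ' = b₁
    · subst h₁
      by_cases h₂ : μ' = b₂
      · subst h₂
        have h₃ : ν' ≠ a₂ := hne rfl rfl
        simp [Pi.single_apply, Prod.ext_iff, Ne.symm h₃]
      · simp [Pi.single_apply, Prod.ext_iff, Ne.symm h₂]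
    · simp [Pi.single_apply, Prod.ext_iff, Ne.symm h₁]

theorem subT_eq_sum_subtype (K : Type) [CommSemiring K] :
    subT keep K = ∑ s : {p : Idx // keep p}, triad (wK keep K s.1) (Pi.single (s.1.1, s.1.2.1) (1 : K))
      (Pi.single (s.1.2.1, s.1.2.2) (1 : K)) := by
  set g : Idx → (Fin 3 × Fin 3 → Fin 3 × Fin 3 → Fin 3 × Fin 3 → K) := fun p =>
    triad (wK keep K p) (Pi.single (p.1, p.2.1) (1 : K)) (Pi.single (p.2.1, p.2.2) (1 : K)) with hg
  have h1 : (∑ p ∈ Finset.univ.filter keep, g p) = ∑ s : {p : Idx // keep p}, g s.1 :=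
    Finset.sum_subtype (Finset.univ.filter keep) (by simp) g
  have h2 : (∑ p ∈ Finset.univ.filter keep, g p) = ∑ p, g p := by
    apply Finset.sum_filter_of_ne
    intro p _ hp
    by_contra hk
    apply hp
    funext a b c
    simp [hg, wK, hk]
  rw [subT_eq_sum_univ, ← h1.symm.trans h2]

theorem tensorRank_subT_le (K : Type) [CommSemiring K] :
    tensorRank (subT keep K) ≤ Fintype.card {p : Idx // keep p} :=
  tensorRank_le_card_of_eq_sum _ _ _ (subT_eq_sum_subtype keep K)

/-- entries are `0/1`, and inside the support of `⟨3,3,3⟩` -/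
theorem subT_mul_matMul (a b c : Fin 3 × Fin 3) :
    subT keep ℂ a b c * matMulTensor ℂ 3 3 3 a b c = subT keep ℂ a b c := by
  simp only [subT, matMulTensor]
  split_ifs <;> simp_all

theorem norm_sq_subT (a b c : Fin 3 × Fin 3) :
    ‖subT keep ℂ a b c‖ ^ 2 = subT keep ℝ a b c := by
  simp only [subT]
  split_ifs <;> simp

theorem subT_eq_natCast (K : Type) [CommSemiring K] (a b c : Fin 3 × Fin 3) :
    subT keep K a b c = ((subT keep ℕ a b c : ℕ) : K) := by
  simp only [subT]
  split_ifs <;> simp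

theorem sum_subT (K : Type) [CommSemiring K] :
    (∑ a, ∑ b, ∑ c, subT keep K a b c) = ((∑ a, ∑ b, ∑ c, subT keep ℕ a b c : ℕ) : K) := by
  simp_rw [subT_eq_natCast keep K]
  push_cast
  rfl

end

/-- keep 17 of the 27 ones: drop the nine with `κ = 2` and `(κ, μ, ν) = (1, 2, 2)` -/
abbrev keep17 (p : Idx) : Prop := p.1 ≠ 2 ∧ ¬ (p.1 = 1 ∧ p.2.1 = 2 ∧ p.2.2 = 2)

theorem card_keep17 : Fintype.card {p : Idx // keep17 p} = 17 := by
  rw [Fintype.card_subtype]; decide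

theorem sum_keep17 : (∑ a, ∑ b, ∑ c, subT keep17 ℕ a b c) = 17 := by
  decide

abbrev S17 : Fin 3 × Fin 3 → Fin 3 × Fin 3 → Fin 3 × Fin 3 → ℂ := subT keep17 ℂ

theorem tensorRank_S17_le : tensorRank S17 ≤ 17 :=
  (tensorRank_subT_le keep17 ℂ).trans card_keep17.le

theorem overlap_S17 : (∑ a, ∑ b, ∑ c, S17 a b c * matMulTensor ℂ 3 3 3 a b c) = (17 : ℂ) := by
  simp_rw [subT_mul_matMul]
  rw [sum_subT keep17 ℂ, sum_keep17]
  norm_num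

theorem normSq_S17 : (∑ a, ∑ b, ∑ c, ‖S17 a b c‖ ^ 2) = (17 : ℝ) := by
  simp_rw [norm_sq_subT]
  rw [sum_subT keep17 ℝ, sum_keep17]
  norm_num


/-- output patterns (slot `a = (κ,ν)`): `u_t (i,l)` = coefficient of `m_t` in `G_il` (t ≤ 15, Tichavský–Phan–Cichocki's `⟨3,3,2⟩:15`, with the printed typo `G₁₁ ∋ m₁₂` corrected to `m₁₅`); `t = 16, 17`: the standard triads of the ones `(κ,μ,ν) = (0,0,2), (1,1,2)` -/
def tpcU : Fin 17 → Fin 3 → Fin 3 → ℤ :=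
  ![![![0, 1, 0], ![0, 0, 0], ![0, 0, 0]],
    ![![0, -1, 0], ![0, 0, 0], ![1, 0, 0]],
    ![![1, 1, 0], ![-1, -1, 0], ![0, 0, 0]],
    ![![-1, -1, 0], ![1, 0, 0], ![0, 0, 0]],
    ![![0, 0, 0], ![0, 0, 0], ![1, 0, 0]],
    ![![1, 1, 0], ![0, 0, 0], ![0, 0, 0]],
    ![![0, 1, 0], ![0, 0, 0], ![0, 1, 0]],
    ![![1, 0, 0], ![-1, 0, 0], ![0, 0, 0]],
    ![![0, 0, 0], ![-1, -1, 0], ![-1, -1, 0]],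
    ![![0, 0, 0], ![0, 0, 0], ![1, 1, 0]],
    ![![0, 0, 0], ![1, 0, 0], ![0, 0, 0]],
    ![![0, 0, 0], ![0, 1, 0], ![0, 0, 0]],
    ![![0, 0, 0], ![0, 1, 0], ![1, 1, 0]],
    ![![0, 0, 0], ![0, -1, 0], ![0, -1, 0]],
    ![![1, 0, 0], ![0, 0, 0], ![1, 0, 0]],
    ![![0, 0, 1], ![0, 0, 0], ![0, 0, 0]],
    ![![0, 0, 0], ![0, 0, 1], ![0, 0, 0]]]

/-- left forms (slot `b = (κ,μ)`): coefficients of `e_ij = A_ij` -/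
def tpcV : Fin 17 → Fin 3 → Fin 3 → ℤ :=
  ![![![1, 1, 0], ![0, 0, 0], ![-1, 0, 0]],
    ![![0, 0, 1], ![0, 0, 0], ![-1, 0, 0]],
    ![![0, 0, 0], ![-1, 0, 0], ![0, 0, 0]],
    ![![0, -1, 0], ![1, 0, 0], ![0, 0, 0]],
    ![![0, 0, -1], ![0, 0, 0], ![0, 1, 1]],
    ![![1, 0, -1], ![1, 0, 0], ![0, 0, 0]],
    ![![0, 0, 0], ![0, 0, 0], ![1, 0, 0]],
    ![![0, -1, 0], ![0, 0, 0], ![0, 0, 0]],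
    ![![0, 0, 0], ![0, 0, 1], ![0, 0, 0]],
    ![![0, 0, 0], ![0, 0, 1], ![1, 0, -1]],
    ![![0, 1, 0], ![0, 1, 1], ![0, 0, 0]],
    ![![0, 0, 0], ![1, 1, 0], ![0, -1, 0]],
    ![![0, 0, 0], ![0, 0, 1], ![0, 1, 0]],
    ![![0, 0, 0], ![0, 0, 0], ![0, 1, 0]],
    ![![0, 0, 1], ![0, 0, 0], ![0, 0, 0]],
    ![![1, 0, 0], ![0, 0, 0], ![0, 0, 0]],
    ![![0, 0, 0], ![0, 1, 0], ![0, 0, 0]]]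

/-- right forms (slot `c = (μ,ν)`): coefficients of `f_jl = B_jl` -/
def tpcW : Fin 17 → Fin 3 → Fin 3 → ℤ :=
  ![![![-1, 1, 0], ![0, 0, 0], ![0, 0, 0]],
    ![![-1, 0, 0], ![0, 0, 0], ![0, -1, 0]],
    ![![0, 1, 0], ![0, -1, 0], ![0, 0, 0]],
    ![![1, -1, 0], ![0, 1, 0], ![0, 0, 0]],
    ![![0, 0, 0], ![0, 0, 0], ![1, -1, 0]],
    ![![1, 0, 0], ![0, 0, 0], ![0, 0, 0]],
    ![![0, 1, 0], ![0, 0, 0], ![0, 1, 0]],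
    ![![1, -1, 0], ![-1, 1, 0], ![0, 0, 0]],
    ![![0, 0, 0], ![1, 0, 0], ![-1, 0, 0]],
    ![![0, 0, 0], ![0, 0, 0], ![0, -1, 0]],
    ![![0, 0, 0], ![1, 0, 0], ![0, 0, 0]],
    ![![0, 0, 0], ![0, 1, 0], ![0, 0, 0]],
    ![![0, 0, 0], ![1, 0, 0], ![-1, 1, 0]],
    ![![0, 0, 0], ![1, -1, 0], ![-1, 1, 0]],
    ![![1, 0, 0], ![0, 0, 0], ![1, 0, 0]],
    ![![0, 0, 1], ![0, 0, 0], ![0, 0, 0]],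
    ![![0, 0, 0], ![0, 0, 1], ![0, 0, 0]]]

/-- the integer tensor `Σ_t u_t ⊗ v_t ⊗ w_t` -/
def S20Z (a b c : Fin 3 × Fin 3) : ℤ := ∑ t : Fin 17, tpcU t a.1 a.2 * tpcV t b.1 b.2 * tpcW t c.1 c.2

theorem S20Z_overlap : (∑ a, ∑ b, ∑ c, S20Z a b c * matMulTensor ℤ 3 3 3 a b c) = 20 := by
  decide +kernel

theorem S20Z_normSq : (∑ a, ∑ b, ∑ c, S20Z a b c ^ 2) = 20 := by
  decide +kernel

/-- the complex tensor -/
def S20 : T3 := fun a b c => ((S20Z a b c : ℤ) : ℂ)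

theorem S20_eq_sum : S20 = ∑ t : Fin 17, triad (fun a : Fin 3 × Fin 3 => ((tpcU t a.1 a.2 : ℤ) : ℂ))
    (fun b => ((tpcV t b.1 b.2 : ℤ) : ℂ)) (fun c => ((tpcW t c.1 c.2 : ℤ) : ℂ)) := by
  funext a b c
  rw [Finset.sum_apply, Finset.sum_apply, Finset.sum_apply]
  simp only [S20, S20Z, triad_apply]
  push_cast
  rfl

theorem tensorRank_S20_le : tensorRank S20 ≤ 17 :=
  tensorRank_le_of_eq_sum _ _ _ S20_eq_sum

theorem matMulTensor_eq_intCast (a b c : Fin 3 × Fin 3) :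
    matMulTensor ℂ 3 3 3 a b c = ((matMulTensor ℤ 3 3 3 a b c : ℤ) : ℂ) := by
  simp only [matMulTensor]
  split_ifs <;> simp

theorem overlap_S20 : (∑ a, ∑ b, ∑ c, S20 a b c * matMulTensor ℂ 3 3 3 a b c) = (20 : ℂ) := by
  simp only [S20, matMulTensor_eq_intCast]
  have h : (∑ a : Fin 3 × Fin 3, ∑ b : Fin 3 × Fin 3, ∑ c : Fin 3 × Fin 3,
      ((S20Z a b c : ℤ) : ℂ) * ((matMulTensor ℤ 3 3 3 a b c : ℤ) : ℂ))
      = (((∑ a, ∑ b, ∑ c, S20Z a b c * matMulTensor ℤ 3 3 3 a b c : ℤ)) : ℂ) := by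
    push_cast
    rfl
  rw [h, S20Z_overlap]
  norm_num

theorem normSq_S20 : (∑ a, ∑ b, ∑ c, ‖S20 a b c‖ ^ 2) = (20 : ℝ) := by
  have h1 : ∀ a b c : Fin 3 × Fin 3, ‖S20 a b c‖ ^ 2 = ((S20Z a b c ^ 2 : ℤ) : ℝ) := by
    intro a b c
    simp only [S20, Complex.norm_intCast]
    push_cast
    exact sq_abs _
  simp_rw [h1]
  have h : (∑ a : Fin 3 × Fin 3, ∑ b : Fin 3 × Fin 3, ∑ c : Fin 3 × Fin 3, ((S20Z a b c ^ 2 : ℤ) : ℝ))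
      = ((∑ a, ∑ b, ∑ c, S20Z a b c ^ 2 : ℤ) : ℝ) := by
    push_cast
    rfl
  rw [h, S20Z_normSq]
  norm_num


/-- **Sharper tightness at the crux**: any gap constant at `(3,17)` has `ε ≤ 7/27`, i.e.
`M(3,17) ≥ 20` (witness `S20`, honest rank `≤ 17`, fidelity `20/27`). -/
theorem gapAt_seventeen_le_seven {ε : ℝ} (h : GapAt 17 ε) : ε ≤ 7 / 27 := by
  have key := h S20 tensorRank_S20_le
  rw [overlap_S20, normSq_S20] at key
  have : ‖(20 : ℂ)‖ = 20 := by
    rw [show (20 : ℂ) = ((20 : ℝ) : ℂ) by norm_num, Complex.norm_real]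
    norm_num
  rw [this] at key
  nlinarith

/-- The strengthening "gap constant `ε > 7/27`" (fidelity below `20/27`) is refuted. -/
theorem not_gapAt_seventeen_of_gt_seven {ε : ℝ} (hε : 7 / 27 < ε) : ¬ GapAt 17 ε :=
  fun h => absurd (gapAt_seventeen_le_seven h) (not_le.mpr hε)

/-- **Tightness at the crux**: any gap constant at `(3,17)` has `ε ≤ 10/27`, i.e. `M(3,17) ≥ 17`
(witness `S17`: 17 of the 27 standard products). -/
theorem gapAt_seventeen_le {ε : ℝ} (h : GapAt 17 ε) : ε ≤ 10 / 27 := by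
  have key := h S17 tensorRank_S17_le
  rw [overlap_S17, normSq_S17] at key
  have : ‖(17 : ℂ)‖ = 17 := by
    rw [show (17 : ℂ) = ((17 : ℝ) : ℂ) by norm_num, Complex.norm_real]
    norm_num
  rw [this] at key
  nlinarith

/-- The natural strengthening "gap constant `ε > 10/27`" (fidelity below `17/27`) is refuted. -/
theorem not_gapAt_seventeen_of_gt {ε : ℝ} (hε : 10 / 27 < ε) : ¬ GapAt 17 ε :=
  fun h => absurd (gapAt_seventeen_le h) (not_le.mpr hε)


/-! ## §3c BORDER tightness: `ε ≤ 2/9` (`M(3,17) ≥ 21`), kernel-checked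

The 0/1 tensor `P21 = subT keep21` (the 21 ones `{μ ≠ 2} ∪ {(i,2,i)}`: the block `⟨3,2,3⟩` plus the
diagonal of the complementary rank-one update `A_{·2}B_{2·}`) has BORDER rank `≤ 17`: Smirnov's
`⟨3,2,3; 14⟩` (Table 4; tree data `Smirnov2013.uTab/vTab/wTab`, re-tabulated here padded into the
`3 × 3` format) plus three monomial triads `x³ e_{ii} ⊗ e_{i2} ⊗ e_{2i}` is an order-`3` approximate
decomposition with `17` triads (`P21Cert.isApproxDecomposition`, `decide +kernel`).  So
`P21 ∈ closure {R ≤ 17}`, the gap inequality (a closed condition, `GapAt.of_mem_closure`) holds at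
`P21` and reads `441 ≤ (1 − ε)·567`: **`ε ≤ 2/9`** (`gapAt_seventeen_le_two_ninths`).  Landing copy:
`Theorems/FidelityGapThreeSeventeen/Negative/BorderTightness.lean` (proposed).  This exhausts PRINTED
schemes: the maximal proper blocks are `⟨3,2,3⟩:14` (optimal, CHL 2023 Thm 1.5(1)), `⟨2,2,3⟩:10`,
`⟨3,1,3⟩ = ⟨3,3,1⟩:9`, and 21/27 is the best ratio reachable inside 17; beyond it a NEW approximate
algorithm is needed (numerics §5). -/

/-- the 21 ones kept: `μ ≠ 2` (the block `⟨3,2,3⟩`, 18 ones) or `μ = 2 ∧ κ = ν` (3 ones) -/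
abbrev keep21 (p : Idx) : Prop := p.2.1 ≠ 2 ∨ p.1 = p.2.2

theorem sum_keep21 : (∑ a, ∑ b, ∑ c, subT keep21 ℕ a b c) = 21 := by
  decide

/-- the border witness `P21` -/
abbrev P21 : T3 := subT keep21 ℂ

theorem overlap_P21 : (∑ a, ∑ b, ∑ c, P21 a b c * matMulTensor ℂ 3 3 3 a b c) = (21 : ℂ) := by
  simp_rw [subT_mul_matMul]
  rw [sum_subT keep21 ℂ, sum_keep21]
  norm_num

theorem normSq_P21 : (∑ a, ∑ b, ∑ c, ‖P21 a b c‖ ^ 2) = (21 : ℝ) := by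
  simp_rw [norm_sq_subT]
  rw [sum_subT keep21 ℝ, sum_keep21]
  norm_num

namespace P21Cert

open Polynomial
open Smirnov2013 (toPoly coeffL pmul psum coeff_toPoly toPoly_pmul toPoly_psum)

/-- `U'ₜ` (`t < 17`): slot of `C` (index `(i,l)`): Smirnov's `x·γᵗ` for `t < 14`, then `x³ e_{ii}` (`i = 0,1,2`) -/
def u21Mats : List (Fin 3 → Fin 3 → List ℤ) :=
  [![![[], [0, -1], [0, 1]], ![[0, -1], [0, 1], [-1]], ![[0, 0, 1], [-1], [1]]],
    ![![[0, 0, 1], [], [0, 0, 0, -1]], ![[], [], [1]], ![[1], [0, -1], [-1]]],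
    ![![[0, 0, 0, -1], [], [0, 0, 0, 1]], ![[], [], []], ![[], [], [1]]],
    ![![[], [], []], ![[0, 1], [], [1]], ![[0, 0, -1], [0, -1], []]],
    ![![[], [], [0, 0, 0, 1]], ![[], [], []], ![[], [], [1]]],
    ![![[], [], []], ![[], [], [-1]], ![[], [0, 1], []]],
    ![![[0, 0, 1], [], []], ![[], [], []], ![[1], [], []]],
    ![![[], [], []], ![[0, 1], [0, -1], [1]], ![[0, 0, -1], [], []]],
    ![![[], [], []], ![[], [], [-1]], ![[], [], []]],
    ![![[], [0, 0, 0, 1], [0, 1]], ![[], [], []], ![[], [], [1]]],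
    ![![[], [], [0, 1]], ![[], [], []], ![[], [], [1]]],
    ![![[0, 0, 0, 1, 1], [], []], ![[0, 1], [0, -1], [1]], ![[], [], []]],
    ![![[], [0, 1], []], ![[], [], []], ![[], [1], []]],
    ![![[], [], []], ![[], [0, -1], [1]], ![[], [], []]],
    ![![[0, 0, 0, 1], [], []], ![[], [], []], ![[], [], []]],
    ![![[], [], []], ![[], [0, 0, 0, 1], []], ![[], [], []]],
    ![![[], [], []], ![[], [], []], ![[], [], [0, 0, 0, 1]]]]

/-- `V'ₜ`: slot of `A` (index `(i,j)`): Smirnov's `x·αᵗ` padded by a zero third column for `t < 14`, then `e_{i2}` -/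
def v21Mats : List (Fin 3 → Fin 3 → List ℤ) :=
  [![![[], [1], []], ![[0, 0, 1], [], []], ![[], [], []]],
    ![![[], [1], []], ![[], [], []], ![[0, 0, 0, 1], [0, -1], []]],
    ![![[-1], [], []], ![[], [], []], ![[0, 1, 0, 1], [], []]],
    ![![[], [], []], ![[0, 1], [], []], ![[], [], []]],
    ![![[-1], [-1], []], ![[], [], []], ![[0, 1], [0, 1], []]],
    ![![[], [-1], []], ![[0, 0, -1], [], []], ![[0, 0, 0, -1], [0, 1], []]],
    ![![[], [-1], []], ![[0, 0, 0, 0, 1], [], []], ![[], [0, 1], []]],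
    ![![[], [-1], []], ![[], [], []], ![[], [], []]],
    ![![[], [1], []], ![[0, 0, 1], [0, -1], []], ![[0, 0, 0, 1], [0, -1], []]],
    ![![[1], [], []], ![[], [], []], ![[], [], []]],
    ![![[1], [1], []], ![[0, 0, 1], [], []], ![[], [], []]],
    ![![[], [1], []], ![[], [0, 0, 1], []], ![[], [], []]],
    ![![[], [1], []], ![[0, 0, 1, 1], [], []], ![[0, 0, 0, 1], [], []]],
    ![![[], [], []], ![[], [0, 1], []], ![[], [], []]],
    ![![[], [], [1]], ![[], [], []], ![[], [], []]],
    ![![[], [], []], ![[], [], [1]], ![[], [], []]],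
    ![![[], [], []], ![[], [], []], ![[], [], [1]]]]

/-- `W'ₜ`: slot of `B` (index `(j,l)`): Smirnov's `x·βᵗ` padded by a zero third row for `t < 14`, then `e_{2i}` -/
def w21Mats : List (Fin 3 → Fin 3 → List ℤ) :=
  [![![[], [1], []], ![[], [], []], ![[], [], []]],
    ![![[1], [], []], ![[], [], []], ![[], [], []]],
    ![![[1], [], [0, 0, 1]], ![[], [], [0, 0, -1]], ![[], [], []]],
    ![![[0, 1], [0, 1], [0, 0, 1]], ![[], [], []], ![[], [], []]],
    ![![[-1], [], []], ![[], [], [0, 0, 1]], ![[], [], []]],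
    ![![[-1], [], []], ![[], [0, 1], []], ![[], [], []]],
    ![![[1], [], []], ![[0, 0, 1], [], []], ![[], [], []]],
    ![![[], [-1], []], ![[1], [], []], ![[], [], []]],
    ![![[], [], []], ![[], [0, 1], []], ![[], [], []]],
    ![![[], [1], [0, 0, 1]], ![[], [], [0, 0, -1]], ![[], [], []]],
    ![![[], [-1], []], ![[], [], [0, 0, 1]], ![[], [], []]],
    ![![[], [], []], ![[1], [], []], ![[], [], []]],
    ![![[], [1], []], ![[], [0, 0, 1], []], ![[], [], []]],
    ![![[], [], []], ![[0, -1], [0, -1], [0, 0, 1]], ![[], [], []]],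
    ![![[], [], []], ![[], [], []], ![[1], [], []]],
    ![![[], [], []], ![[], [], []], ![[], [1], []]],
    ![![[], [], []], ![[], [], []], ![[], [], [1]]]]

def uTab (t : Fin 17) : Fin 3 → Fin 3 → List ℤ := u21Mats.getD t fun _ _ => []
def vTab (t : Fin 17) : Fin 3 → Fin 3 → List ℤ := v21Mats.getD t fun _ _ => []
def wTab (t : Fin 17) : Fin 3 → Fin 3 → List ℤ := w21Mats.getD t fun _ _ => []

/-- entry `((i,l),(i',j),(j',l'))` of `∑ₜ U'ₜ ⊗ V'ₜ ⊗ W'ₜ` as an integer polynomial -/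
def entryPoly (i l i' j j' l' : Fin 3) : List ℤ :=
  psum (List.ofFn fun t : Fin 17 => pmul (pmul (uTab t i l) (vTab t i' j)) (wTab t j' l'))

/-- expected coefficients: `x³ · P21`, nothing below degree `3` -/
def rhsZ (i l i' j j' l' : Fin 3) (d : ℕ) : ℤ :=
  if d = 3 then (if (i = i' ∧ j = j' ∧ l = l') ∧ (j ≠ 2 ∨ i' = l) then 1 else 0) else 0

def checkEntry (i l i' j j' l' : Fin 3) : Bool :=
  let p := entryPoly i l i' j j' l'
  (List.range 4).all fun d => coeffL p d == rhsZ i l i' j j' l' d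

/-- the finite check: all `9·9·9` entries, degrees `0,…,3` -/
def check21 : Bool :=
  (List.finRange 3).all fun i => (List.finRange 3).all fun l => (List.finRange 3).all fun i' =>
    (List.finRange 3).all fun j => (List.finRange 3).all fun j' => (List.finRange 3).all fun l' =>
      checkEntry i l i' j j' l'

/-- the kernel runs the check (THE TEMPLATE of a kill certificate: 17 triads, here for 21 ones) -/
theorem check21_eq_true : check21 = true := by
  decide +kernel

theorem coeffL_entryPoly (i l i' j j' l' : Fin 3) {d : ℕ} (hd : d ≤ 3) :
    coeffL (entryPoly i l i' j j' l') d = rhsZ i l i' j j' l' d := by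
  have h := check21_eq_true
  simp only [check21, List.all_eq_true] at h
  have h' : checkEntry i l i' j j' l' = true :=
    h i (List.mem_finRange i) l (List.mem_finRange l) i' (List.mem_finRange i')
      j (List.mem_finRange j) j' (List.mem_finRange j') l' (List.mem_finRange l')
  simp only [checkEntry, List.all_eq_true, beq_iff_eq] at h'
  exact h' d (List.mem_range.2 (by omega))

section Transport
variable (K : Type) [CommRing K]

noncomputable def uC (t : Fin 17) (a : Fin 3 × Fin 3) : K[X] := toPoly (uTab t a.1 a.2)
noncomputable def vC (t : Fin 17) (b : Fin 3 × Fin 3) : K[X] := toPoly (vTab t b.1 b.2)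
noncomputable def wC (t : Fin 17) (c : Fin 3 × Fin 3) : K[X] := toPoly (wTab t c.1 c.2)

/-- **Order-`3` approximate decomposition of `P21` with `17` triads** (every commutative ring). -/
theorem isApproxDecomposition :
    IsApproxDecomposition 3 (subT keep21 K) (uC K) (vC K) (wC K) := by
  intro a b c d hd
  have hsum : (∑ t, uC K t a * vC K t b * wC K t c) =
      toPoly (entryPoly a.1 a.2 b.1 b.2 c.1 c.2) := by
    rw [entryPoly, toPoly_psum, List.map_ofFn, List.sum_ofFn]
    refine Finset.sum_congr rfl fun t _ => ?_
    simp only [Function.comp_apply, toPoly_pmul, uC, vC, wC]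
  rw [hsum, coeff_toPoly, coeffL_entryPoly _ _ _ _ _ _ hd, rhsZ]
  simp only [subT]
  split_ifs <;> simp_all

end Transport

end P21Cert

/-- `R₃(P21) ≤ 17` -/
theorem approxRank_three_P21_le : approxRank 3 P21 ≤ 17 :=
  approxRank_le_of_isApproxDecomposition (P21Cert.isApproxDecomposition ℂ)

/-- **`bR(P21) ≤ 17`**: 21 of the 27 unit products by 17 border multiplications. -/
theorem algBorderRank_P21_le : algBorderRank P21 ≤ 17 :=
  (algBorderRank_le_approxRank 3 _).trans approxRank_three_P21_le

theorem P21_mem_closure : P21 ∈ closure {S : T3 | tensorRank S ≤ 17} :=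
  mem_closure_setOf_tensorRank_le_of_algBorderRank_le algBorderRank_P21_le

/-- a gap inequality is a CLOSED condition: it passes to limits of rank-`≤ r` tensors -/
theorem GapAt.of_mem_closure {r : ℕ} {ε : ℝ} (h : GapAt r ε) {S : T3}
    (hS : S ∈ closure {S : T3 | tensorRank S ≤ r}) :
    ‖∑ a, ∑ b, ∑ c, S a b c * matMulTensor ℂ 3 3 3 a b c‖ ^ 2 ≤
      (1 - ε) * 27 * ∑ a, ∑ b, ∑ c, ‖S a b c‖ ^ 2 := by
  have hclosed : IsClosed {S : T3 | ‖∑ a, ∑ b, ∑ c, S a b c * matMulTensor ℂ 3 3 3 a b c‖ ^ 2 ≤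
      (1 - ε) * 27 * ∑ a, ∑ b, ∑ c, ‖S a b c‖ ^ 2} :=
    isClosed_le (by fun_prop) (by fun_prop)
  exact closure_minimal (fun S hS => h S hS) hclosed hS

/-- **Border tightness at the crux**: every gap constant at `(3,17)` has `ε ≤ 2/9` (`M(3,17) ≥ 21`). -/
theorem gapAt_seventeen_le_two_ninths {ε : ℝ} (h : GapAt 17 ε) : ε ≤ 2 / 9 := by
  have key := h.of_mem_closure P21_mem_closure
  rw [overlap_P21, normSq_P21] at key
  have : ‖(21 : ℂ)‖ = 21 := by
    rw [show (21 : ℂ) = ((21 : ℝ) : ℂ) by norm_num, Complex.norm_real]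
    norm_num
  rw [this] at key
  nlinarith

/-- The fixed-`ε` strengthening with any `ε > 2/9` (fidelity bound below `21/27 = 7/9`) is refuted. -/
theorem not_gapAt_seventeen_of_gt_two_ninths {ε : ℝ} (hε : 2 / 9 < ε) : ¬ GapAt 17 ε :=
  fun h => absurd (gapAt_seventeen_le_two_ninths h) (not_le.mpr hε)


/-! ## §3e The numerical optimum at `r = 17`: honest `ε ≤ 0.18524`, conjecturally the BORDER value `22`

Kit job `j010991` (cycle 2; ridge-continuation ALS + LM polish, real factors, 655 restarts at `r = 17` from
Gaussian / standard-minus-k / TPC / Smirnov-20-minus-3 seeds) found `inf ‖⟨3,3,3⟩ − S‖² ≈ 5.00086` over honest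
rank-17 tensors, i.e. `M(3,17) ≥ 21.99914`, with ALL 17 triad norms between 59 and 327 (`‖S‖ ≈ 4.7`): a fully
degenerating (border) configuration.  Rationalised (`k/8192`) and re-verified exactly it is the integer witness of
`Theorems/FidelityGapThreeSeventeen/Negative/TightnessHonest.lean` (`ε ≤ 4631/25000 ≈ 0.18524`, fidelity·27
`= 21.9987`; proposal pending at the time of writing).  STRUCTURE of the limit (session scripts `spectra.py`,
`eigid.py`): the Gram spectra of the three flattenings of the optimum are INTEGERS — `(3,3,3,3,3,2,2,2,1)` on the
`C`- and `A`-slots, `(3,3,3,3,3,3,2,2,0)` on the `B`-slot — and the special eigenvectors are rank-one `3 × 3`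
arrays, so the limit is a stabiliser-twist `K·P` of a 0/1 SUB-TENSOR `P` of `⟨3,3,3⟩` with 22 ones; the incidence
of the rank-one components (`i`: different, `j`: equal, `l`: equal) singles out ONE of the four classes of 5-sets
compatible with the spectra: `E₄ = {(i,0,0) : i} ∪ {(0,0,1), (1,1,0)}` (coordinates `(κ,μ,ν) = (i,j,l)`), i.e.
`b₀₀` unused, and the two products `a₀₀b₀₁`, `a₁₁b₁₀` dropped.  CONJECTURE (numerical): `bR(P22) ≤ 17` for
`P22 := ⟨3,3,3⟩ − 1_{E₄}`; then `ε ≤ 5/27` exactly (`gapAt_seventeen_le_five_27_of_conj`, proved modulo the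
conjecture), and `5/27 ≈ 0.18519` would be the SHARP constant of the crux if the crux holds.  The same runs show an
integer STAIRCASE `M(3,r) ≈ 19, 20, 22, 23, 25, 27` (`d_r² ≈ 8.0005, 7.00002, 5.0009, 4.0005, 2.03, 0.12`) for
`r = 15, …, 20`; at `r = 19` the spectra point to `⟨3,3,3⟩` minus two products of one `a_{ij}` (25 ones), at
`r = 18` to 23 ones (11 candidate classes; test job `j014574`).  Reading for the crux: 17 border multiplications
appear to buy at most 22 of the 27 unit products — numerical evidence FOR the crux (with the TPC caveat of §5). -/

/-- the 22 ones kept: drop the fibre `μ = ν = 0` (the entry `b₀₀`) and the ones `(0,0,1)`, `(1,1,0)` -/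
abbrev keep22 (p : Idx) : Prop := ¬ ((p.2.1 = 0 ∧ p.2.2 = 0) ∨ p = (0, 0, 1) ∨ p = (1, 1, 0))

theorem sum_keep22 : (∑ a, ∑ b, ∑ c, subT keep22 ℕ a b c) = 22 := by
  decide

/-- the conjectural border witness `P22 = ⟨3,3,3⟩ − 1_{E₄}` -/
abbrev P22 : T3 := subT keep22 ℂ

theorem overlap_P22 : (∑ a, ∑ b, ∑ c, P22 a b c * matMulTensor ℂ 3 3 3 a b c) = (22 : ℂ) := by
  simp_rw [subT_mul_matMul]
  rw [sum_subT keep22 ℂ, sum_keep22]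
  norm_num

theorem normSq_P22 : (∑ a, ∑ b, ∑ c, ‖P22 a b c‖ ^ 2) = (22 : ℝ) := by
  simp_rw [norm_sq_subT]
  rw [sum_subT keep22 ℝ, sum_keep22]
  norm_num

/-- **NEAR-MISS (conjecture from numerics, NOT proved)**: `bR(P22) ≤ 17` — 22 of the 27 unit products of
`3 × 3` matrix multiplication (all but `b₀₀`'s three and `a₀₀b₀₁`, `a₁₁b₁₀`) by 17 border multiplications.
Evidence: the `r = 17` optimum of `j010991` converges to a stabiliser-twist of `P22` (integer Gram spectra,
rank-one special eigenvectors, incidence pattern of class `E₄`; §3e).  Obstruction: an EXACT order-`h` scheme has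
not been extracted from the degenerating numerical family (all 17 triads diverge; exponent fitting by
`λ`-continuation queued as kit `j014574`); the certificate would be checked exactly like `P21Cert` (§3c). -/
theorem conj_algBorderRank_P22_le : algBorderRank P22 ≤ 17 := by
  sorry

/-- **Modulo the conjecture, the sharp-looking bound `ε ≤ 5/27`** (sorry-free implication). -/
theorem gapAt_seventeen_le_five_27_of_conj (hP : algBorderRank P22 ≤ 17) {ε : ℝ} (h : GapAt 17 ε) :
    ε ≤ 5 / 27 := by
  have key := h.of_mem_closure (mem_closure_setOf_tensorRank_le_of_algBorderRank_le hP)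
  rw [overlap_P22, normSq_P22] at key
  have : ‖(22 : ℂ)‖ = 22 := by
    rw [show (22 : ℂ) = ((22 : ℝ) : ℂ) by norm_num, Complex.norm_real]
    norm_num
  rw [this] at key
  nlinarith


/-! ## §3d The border-rank-hypothesis strengthening is free

Replacing the hypothesis `tensorRank S ≤ r` by `algBorderRank S ≤ r` (more tensors `S` to control)
gives an equivalent statement, because the gap inequality is closed and `{R̲ ≤ r} ⊆ closure {R ≤ r}`.
So a prover may assume only `R̲(S) ≤ 17`, and a refuter gains nothing from border-rank-17 test
tensors beyond limits of honest ones (this is how `P21` enters §3c). -/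

/-- the gap inequality demanded of all tensors of BORDER rank `≤ r` -/
def GapAtBorder (r : ℕ) (ε : ℝ) : Prop :=
  ∀ S : T3, algBorderRank S ≤ r →
    ‖∑ a, ∑ b, ∑ c, S a b c * matMulTensor ℂ 3 3 3 a b c‖ ^ 2 ≤
      (1 - ε) * 27 * ∑ a, ∑ b, ∑ c, ‖S a b c‖ ^ 2

theorem gapAtBorder_iff (r : ℕ) (ε : ℝ) : GapAtBorder r ε ↔ GapAt r ε :=
  ⟨fun h S hS => h S ((algBorderRank_le_tensorRank S).trans hS),
    fun h _ hS => h.of_mem_closure (mem_closure_setOf_tensorRank_le_of_algBorderRank_le hS)⟩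

/-- the crux with border-rank hypothesis is the same crux -/
theorem crux_iff_border : FidelityGapThreeSeventeen ↔ ∃ ε : ℝ, 0 < ε ∧ GapAtBorder 17 ε := by
  simp only [gapAtBorder_iff]
  rfl


/-! ## §4 Natural strengthenings / neighbours (status)

* `r ≥ 20`: refuted (§2).  `r = 18, 19`: OPEN exactly like the crux (same reduction:
  `FidelityGapThree r ↔ r < R̲(⟨3,3,3⟩)`), so nothing is gained by weakening the crux to `r = 18/19`
  for a disproof, and nothing is lost for a proof by strengthening to them.
* Fixed-`ε` strengthenings: `ε > 10/27`, `ε > 7/27` refuted by honest rank-17 tensors (§3), `ε > 2/9` by the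
  border witness `P21` (§3c); the numerics (§5) indicate the true threshold.
* No cheap neighbour from Smirnov's 20 (cycle 2, exact check `smirnov_subsets2.py`): no proper
  sub-family `D` of the 20 triads has vanishing orders `0…5` (so no `T − L_D` of border rank `20 − |D|`
  falls out by deletion), and the only triad reweightings keeping orders `0…5` zero are the constants
  (kernel dimension 1): the scheme is rigidly coupled.
* Real vs complex: the crux quantifies over COMPLEX rank-≤17 tensors; a real border scheme would
  refute it as well (real rank-≤17 tensors are complex rank-≤17 tensors).  All known small border
  schemes (Bini, Schönhage, Smirnov) are over `ℤ[x, x⁻¹]`.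

## §5 Numerics and WHY IT RESISTS (cycle 2)

* Cycle-1 kit jobs (`j007940 j007944 j008940 j008988 j009412 j007906`: ALS / seeded TRF / border-ALS /
  `ℤ₃`-invariant searches) were owned by the generation-1 seat; their outputs never reached the item
  (the seat ended before delivery) and are inaccessible to later seats — LOST.  Redone in cycle 2 with
  `--workitem stmt-MatrixMultiplication-4958`, so the summaries attach to the item whoever reads them:
  `j010991` (als-R: `d_r² = inf_{R(S) ≤ r} ‖⟨3,3,3⟩ − S‖²`, `M(3,r) = 27 − d_r²`, real factors,
  `r = 15…21`, ridge-continuation ALS + LM polish; seeds Gaussian / standard-minus-k / TPC `S20` /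
  Smirnov-20 at `x ∈ {.5,.35,.25,.15}` minus k), `j010992` (als-C: complex factors), `j010996` (deep: long
  runs at `r = 17, 18, 19`, plateau clustering), `j010997` (z3sym: `ℤ₃`-invariant ansatz
  `σ(u,v,w) = (vᵀ,w,uᵀ)`, `r = 3k+f ∈ {17 (5:2, 4:5, 3:8), 18, 19, 20, 23}`, real and complex; a border
  scheme shows as residual → 0 with diverging triad norms).  Scripts in the session folder
  (`jobs/alsjob`, `jobs/z3job`, `jobs/s3job`).
* RESULTS `j010991` (als-R, 2 cores × 27 min): best `d_r² = ‖⟨3,3,3⟩ − S‖²` over honest rank-`r` real tensors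
  (restarts): `r=15: 8.0005 (278)`, `16: 7.00002 (346)`, `17: 5.00086 (655)`, `18: 4.0005 (382)`, `19: 2.028 (343)`,
  `20: 0.119 (225)`, `21: 0.009 (130)`; i.e. `M(3,r) ≥ 18.9995, 19.99998, 21.99914, 22.9995, 24.97, 26.88, 26.99`.
  Plateau histograms cluster at INTEGERS (`10/9/8`, `8/7`, `5.59/5`, `5/4`, `3/2.7/2.3/2.03`, `3/2/0.12`); all best
  values come from Smirnov-20-minus-k seeds and have diverging triad norms (border).  Interpretation §3e: a
  STAIRCASE of 0/1 sub-tensors of border rank `r` with `19, 20, 22, 23, 25, 27` ones; NO run at `r ≤ 19` approaches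
  27 (the calibration `r = 20` reaches 0.119 = Smirnov's neighbourhood at finite `x`, `r = 21` 0.009).  Pending:
  `j010992` (complex), `j010996` (deep), `j010997`/`j011745` (ℤ₃/S₃ ansätze), `j014574` (sub-tensor class tests +
  λ-continuation for the `P22` scheme extraction).
* READING RULE (Tichavský–Phan–Cichocki 2017, arXiv:1603.01372 §4.1): their constrained-LM study
  conjectured `R̲(⟨3,3,3⟩) = 21` and MISSED Smirnov's 20 — order-6 degenerations with factor growth `x⁻²`
  per factor are nearly invisible to local search.  Numerical plateaus at `r = 17` are weak evidence FOR
  the crux; only a found scheme (§1b format) is decisive against it.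
* Landed: `Negative/BorderRankReduction.lean` (p73201: kill switch, closure form, `¬crux → R̲ ≤ 17`,
  `crux → 18 ≤ R̲`, `r ≥ 20` false); `Negative/Tightness.lean` (p73854: `ε ≤ 7/27`);
  `Negative/BorderTightness.lean` (cycle 2, proposed: `ε ≤ 2/9`, `bR(P21) ≤ 17`).
* WHY IT RESISTS: by §1 a disproof is PRECISELY a border-rank-17 approximate bilinear algorithm for
  `3 × 3` matrices.  Best known: 20 (Smirnov 2013, kernel-checked in the tree); 21 (Schönhage 1981)
  stood 32 years before it; the symmetry-assisted searches of Conner–Gesmundo–Landsberg–Ventura /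
  Conner–Huang–Landsberg (which found `bR(det₃) ≤ 17`, tree file `BorderRankCWDet3Seventeen`) did not
  move `⟨3,3,3⟩` below 20.  Lower side: Koszul flattenings 15/16, border substitution + Koszul 16
  (LM 2018, tree theorem), border apolarity 17 (CHL 2023) — and CHL's degree-3 tests do NOT reach 18
  (ideator k3 baseline: 3522 (111)-passing triples at r = 17).  Three open rungs; nothing structural
  singles out 17.  The refuter's honest weapons are search (numerical ALS/LM with border diagnostics,
  symmetric ansätze; later SAT/Gröbner on restricted coefficient families) — running — and the
  printed-scheme frontier, now fully formalised (`M(3,17) ≥ 21`).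
-/

end Summit.MatrixMultiplication.MatrixMultiplication.Cruxes.FidelityGapThreeSeventeen.Disproof
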